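import Mathlib
import HarnessLib
import Summits.ValiantsHypothesis.ValiantsHypothesis.Theorems.LacunarySymmetroidMatrixDescartesProductPlusOneSlopeKnee
import Summits.ValiantsHypothesis.ValiantsHypothesis.Theorems.LacunarySymmetroidMatrixDescartesProductPlusOneOneBump

/-!
# LINE (A) `product_plus_one` (crux `MatrixDescartes`, stmt-ValiantsHypothesis-18050, V1) — W-CB, brick C2: RING GEOMETRY
# (the functional «off the ring» hypotheses of the order-6 cells as EXPLICIT RATIONAL ZONES)

Pen val-idea-25 g6 memo §30.5, item C2 (crit-1 #252 rider: the radius must be an explicit function of `(e₁,e₂)`).  The cells ✓/⧗ E3b `…SixthOrderCell`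
(K12 / K02 items) and E3c `…EqualGapCell` (K02 item) carry, for a ringed knee row, the functional hypothesis `∀ x ∈ (u,v), 0 < c₀ + c₁ψ₁(x) + 5040ψ₁(x)²`.
Here it is converted into GEOMETRY: for a binomial knee with letters `β + γ` (same sign) one has `|ψ₁| = ρ²|βγ|/(β+γ)²`, hence `|ψ₁| ≤ ρ²κ` as soon as
`|γ| ≤ κ|β|` or `|β| ≤ κ|γ|` (§2), and the bracket is positive as soon as `c₁|ψ₁| ≤ c₀` (§1).  So the ZONE of a ringed knee of rate `ρ` with letters
`(b_lo, b_hi)` is contained in `{x : κ|b_lo| < |b_hi|x^ρ < |b_lo|/κ}` with the RATIONAL `κ = c₀/(c₁ρ²)`: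
* middle knee under `L₃` (rate `s = e₂+1`, `p = e₁+1 < s`): `κ = (s−p)(2s+p)/(40s²)` (★ `sixthOrder_midKnee_offRing`);
* fast knee under `L₃` (rate `p+s`): `κ = (12p⁴+56p³s+89p²s²+56ps³+12s⁴)/(20(12p²+26ps+12s²)(p+s)²)` (★ `sixthOrder_fastKnee_offRing`);
* fast knee under `L_eq` (equal gaps, rate `2a`): `κ = 1/32` (★ `equalGap_fastKnee_offRing`);
each in the WINDOW-ENDPOINT form «`|b_hi|·v^ρ ≤ κ|b_lo|` (window left of the zone) or `|b_lo| ≤ κ|b_hi|·u^ρ` (right of it)» ⇒ the cell's hypothesis on `(u,v)`.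
Zone log-width `(2/ρ)·log(1/κ)`: a bounded neighbourhood of the knee's centre, uniformly in the company — what the accounting (ACC-Λ, §30.1) sums.

HONEST FRAMING: elementary inequalities; proves nothing about `WronskianBudgetK3` / `OneChangeFloorK3` / the stubs / 18050 / `MatrixDescartes` / B; `VP ≠ VNP` is
NOT proved.  No definitions, no named facts, no sorry; Mathlib + ✓ lane modules (`rowPsi1` closed forms) only.
-/

set_option linter.dupNamespace false

namespace Summit.ValiantsHypothesis.ValiantsHypothesis.Theorems.LacunarySymmetroidMatrixDescartes

namespace ProductPlusOne

open Set
open scoped BigOperators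

/-! ### §1 Brackets are positive at small `|ψ|` -/

/-- `c₀ > 0`, `|c₁ψ| ≤ c₀` ⇒ `c₀ + c₁ψ + 5040ψ² > 0`. [folklore] -/
theorem quadBracket_pos_of_abs_le {c₀ c₁ ψ : ℝ} (h0 : 0 < c₀) (h : |c₁ * ψ| ≤ c₀) : 0 < c₀ + c₁ * ψ + 5040 * ψ ^ 2 := by
  have h1 : -c₀ ≤ c₁ * ψ := (abs_le.mp h).1
  rcases eq_or_ne ψ 0 with hψ | hψ
  · rw [hψ]; simpa using h0
  · have h2 : 0 < ψ ^ 2 := by positivity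
    linarith

/-! ### §2 The size of `ψ₁` at a binomial knee -/

/-- Core inequality: letters `β, γ` of the same sign with `|γ| ≤ κ|β|` or `|β| ≤ κ|γ|` ⇒ `|βγ| ≤ κ(β+γ)²`. [folklore] -/
theorem abs_mul_le_mul_sq_add {β γ κ : ℝ} (hβγ : 0 < β * γ) (h : |γ| ≤ κ * |β| ∨ |β| ≤ κ * |γ|) : |β * γ| ≤ κ * (β + γ) ^ 2 := by
  have hβ : β ≠ 0 := by rintro rfl; simp at hβγ
  have hγ : γ ≠ 0 := by rintro rfl; simp at hβγ
  have hβa : 0 < |β| := abs_pos.mpr hβ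
  have hγa : 0 < |γ| := abs_pos.mpr hγ
  have hsq : (β + γ) ^ 2 = (|β| + |γ|) ^ 2 := by
    have : |β * γ| = β * γ := abs_of_pos hβγ
    rw [abs_mul] at this
    nlinarith [sq_abs β, sq_abs γ]
  rw [abs_mul, hsq]
  rcases h with h | h
  · have hκ : 0 ≤ κ := by
      by_contra hk; push Not at hk; nlinarith
    calc |β| * |γ| ≤ |β| * (κ * |β|) := by gcongr
      _ = κ * |β| ^ 2 := by ring
      _ ≤ κ * (|β| + |γ|) ^ 2 := by gcongr; nlinarith
  · have hκ : 0 ≤ κ := by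
      by_contra hk; push Not at hk; nlinarith
    calc |β| * |γ| ≤ (κ * |γ|) * |γ| := by gcongr
      _ = κ * |γ| ^ 2 := by ring
      _ ≤ κ * (|β| + |γ|) ^ 2 := by gcongr; nlinarith

variable (e₁ e₂ : ℕ)

/-- **Middle-pair knee** (`A = 0`, `B·C > 0`, rate `s = e₂+1`): `|ψ₁| ≤ s²κ` whenever `|C|x^s ≤ κ|B|` or `|B| ≤ κ|C|x^s`. [this file's lemma] -/
theorem pair12_knee_abs_rowPsi1_le (B C : ℝ) {x κ : ℝ} (hx : 0 < x) (hBC : 0 < B * C)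
    (h : |C| * x ^ (e₂ + 1) ≤ κ * |B| ∨ |B| ≤ κ * (|C| * x ^ (e₂ + 1))) :
    |rowPsi1 e₁ e₂ 0 B C x| ≤ ((e₂ : ℝ) + 1) ^ 2 * κ := by
  have hβγ : 0 < (B * x ^ (e₁ + 1)) * (C * x ^ (e₁ + e₂ + 2)) := by
    have : (B * x ^ (e₁ + 1)) * (C * x ^ (e₁ + e₂ + 2)) = (x ^ (e₁ + 1) * x ^ (e₁ + e₂ + 2)) * (B * C) := by ring
    rw [this]; positivity
  have hF : (0 : ℝ) - B * x ^ (e₁ + 1) - C * x ^ (e₁ + e₂ + 2) ≠ 0 := by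
    intro h0
    have hB : B * x ^ (e₁ + 1) = -(C * x ^ (e₁ + e₂ + 2)) := by linarith
    rw [hB] at hβγ
    nlinarith [sq_nonneg (C * x ^ (e₁ + e₂ + 2))]
  rw [pair12_rowPsi1_eq e₁ e₂ B C hF]
  unfold rowU
  have hβγ' : 0 < (-(B * x ^ (e₁ + 1))) * (-(C * x ^ (e₁ + e₂ + 2))) := by linarith
  have hcore := abs_mul_le_mul_sq_add (κ := κ) hβγ' (by
    rw [abs_neg, abs_neg, abs_mul, abs_mul, abs_of_pos (pow_pos hx _), abs_of_pos (pow_pos hx _)]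
    have hxp : 0 < x ^ (e₁ + 1) := pow_pos hx _
    rcases h with h | h
    · left
      have : |C| * x ^ (e₁ + e₂ + 2) = (|C| * x ^ (e₂ + 1)) * x ^ (e₁ + 1) := by ring
      rw [this]
      calc |C| * x ^ (e₂ + 1) * x ^ (e₁ + 1) ≤ (κ * |B|) * x ^ (e₁ + 1) := by gcongr
        _ = κ * (|B| * x ^ (e₁ + 1)) := by ring
    · right
      calc |B| * x ^ (e₁ + 1) ≤ (κ * (|C| * x ^ (e₂ + 1))) * x ^ (e₁ + 1) := by gcongr
        _ = κ * (|C| * x ^ (e₁ + e₂ + 2)) := by ring)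
  have hsum : (0 - B * x ^ (e₁ + 1) - C * x ^ (e₁ + e₂ + 2)) = (-(B * x ^ (e₁ + 1))) + (-(C * x ^ (e₁ + e₂ + 2))) := by ring
  have hne : (-(B * x ^ (e₁ + 1))) + (-(C * x ^ (e₁ + e₂ + 2))) ≠ 0 := by rw [← hsum]; exact hF
  have hsq : 0 < ((-(B * x ^ (e₁ + 1))) + (-(C * x ^ (e₁ + e₂ + 2)))) ^ 2 := by positivity
  rw [hsum]
  rw [show -(((e₂ : ℝ) + 1) ^ 2 * (B * x ^ (e₁ + 1) * (C * x ^ (e₁ + e₂ + 2))))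
      * ((-(B * x ^ (e₁ + 1)) + -(C * x ^ (e₁ + e₂ + 2)))⁻¹) ^ 2
      = -(((e₂ : ℝ) + 1) ^ 2 * (((-(B * x ^ (e₁ + 1))) * (-(C * x ^ (e₁ + e₂ + 2))))
        / ((-(B * x ^ (e₁ + 1))) + (-(C * x ^ (e₁ + e₂ + 2)))) ^ 2)) by
    field_simp]
  rw [abs_neg, abs_mul, abs_of_nonneg (by positivity : (0 : ℝ) ≤ ((e₂ : ℝ) + 1) ^ 2), abs_div, abs_of_pos hsq]
  have := div_le_of_le_mul₀ hsq.le (by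
    have : 0 ≤ κ * ((-(B * x ^ (e₁ + 1))) + (-(C * x ^ (e₁ + e₂ + 2)))) ^ 2 := le_trans (abs_nonneg _) hcore
    exact nonneg_of_mul_nonneg_left this hsq) hcore
  exact mul_le_mul_of_nonneg_left this (by positivity)

/-- **Bottom-pair knee** (`C = 0`, `A·B < 0`, rate `p = e₁+1`): `|ψ₁| ≤ p²κ` whenever `|B|x^p ≤ κ|A|` or `|A| ≤ κ|B|x^p`. [this file's lemma] -/
theorem pair01_knee_abs_rowPsi1_le (A B : ℝ) {x κ : ℝ} (hx : 0 < x) (hAB : A * B < 0)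
    (h : |B| * x ^ (e₁ + 1) ≤ κ * |A| ∨ |A| ≤ κ * (|B| * x ^ (e₁ + 1))) :
    |rowPsi1 e₁ e₂ A B 0 x| ≤ ((e₁ : ℝ) + 1) ^ 2 * κ := by
  have hβγ : 0 < A * (-(B * x ^ (e₁ + 1))) := by
    have : A * (-(B * x ^ (e₁ + 1))) = x ^ (e₁ + 1) * (-(A * B)) := by ring
    rw [this]; exact mul_pos (pow_pos hx _) (by linarith)
  have hF : A - B * x ^ (e₁ + 1) ≠ 0 := by
    intro h0
    have hA : A = B * x ^ (e₁ + 1) := by linarith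
    rw [hA] at hβγ
    nlinarith [sq_nonneg (B * x ^ (e₁ + 1))]
  rw [pair01_rowPsi1_eq e₁ e₂ A B hF]
  unfold rowU
  simp only [zero_mul, sub_zero]
  have hcore := abs_mul_le_mul_sq_add (κ := κ) hβγ (by
    rw [abs_neg, abs_mul, abs_of_pos (pow_pos hx _)]
    exact h)
  have hsum : A - B * x ^ (e₁ + 1) = A + (-(B * x ^ (e₁ + 1))) := by ring
  have hsq : 0 < (A + (-(B * x ^ (e₁ + 1)))) ^ 2 := by rw [← hsum]; positivity
  rw [hsum]
  rw [show ((e₁ : ℝ) + 1) ^ 2 * (B * x ^ (e₁ + 1)) * A * ((A + -(B * x ^ (e₁ + 1)))⁻¹) ^ 2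
      = -(((e₁ : ℝ) + 1) ^ 2 * ((A * (-(B * x ^ (e₁ + 1)))) / (A + (-(B * x ^ (e₁ + 1)))) ^ 2)) by
    field_simp]
  rw [abs_neg, abs_mul, abs_of_nonneg (by positivity : (0 : ℝ) ≤ ((e₁ : ℝ) + 1) ^ 2), abs_div, abs_of_pos hsq]
  have := div_le_of_le_mul₀ hsq.le (by
    have : 0 ≤ κ * (A + (-(B * x ^ (e₁ + 1)))) ^ 2 := le_trans (abs_nonneg _) hcore
    exact nonneg_of_mul_nonneg_left this hsq) hcore
  exact mul_le_mul_of_nonneg_left this (by positivity)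

/-- **Outer-pair knee** (`B = 0`, `A·C < 0`, rate `p+s = e₁+e₂+2`): `|ψ₁| ≤ (p+s)²κ` whenever `|C|x^{p+s} ≤ κ|A|` or `|A| ≤ κ|C|x^{p+s}`. [this file's lemma] -/
theorem knee_abs_rowPsi1_le (A C : ℝ) {x κ : ℝ} (hx : 0 < x) (hAC : A * C < 0)
    (h : |C| * x ^ (e₁ + e₂ + 2) ≤ κ * |A| ∨ |A| ≤ κ * (|C| * x ^ (e₁ + e₂ + 2))) :
    |rowPsi1 e₁ e₂ A 0 C x| ≤ ((e₁ : ℝ) + e₂ + 2) ^ 2 * κ := by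
  have hβγ : 0 < A * (-(C * x ^ (e₁ + e₂ + 2))) := by
    have : A * (-(C * x ^ (e₁ + e₂ + 2))) = x ^ (e₁ + e₂ + 2) * (-(A * C)) := by ring
    rw [this]; exact mul_pos (pow_pos hx _) (by linarith)
  have hF : A - C * x ^ (e₁ + e₂ + 2) ≠ 0 := by
    intro h0
    have hA : A = C * x ^ (e₁ + e₂ + 2) := by linarith
    rw [hA] at hβγ
    nlinarith [sq_nonneg (C * x ^ (e₁ + e₂ + 2))]
  rw [knee_rowPsi1_eq e₁ e₂ A C hF]
  unfold rowU
  simp only [zero_mul, sub_zero]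
  have hcore := abs_mul_le_mul_sq_add (κ := κ) hβγ (by
    rw [abs_neg, abs_mul, abs_of_pos (pow_pos hx _)]
    exact h)
  have hsum : A - C * x ^ (e₁ + e₂ + 2) = A + (-(C * x ^ (e₁ + e₂ + 2))) := by ring
  have hsq : 0 < (A + (-(C * x ^ (e₁ + e₂ + 2)))) ^ 2 := by rw [← hsum]; positivity
  rw [hsum]
  rw [show ((e₁ : ℝ) + e₂ + 2) ^ 2 * (A * C) * x ^ (e₁ + e₂ + 2) * ((A + -(C * x ^ (e₁ + e₂ + 2)))⁻¹) ^ 2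
      = -(((e₁ : ℝ) + e₂ + 2) ^ 2 * ((A * (-(C * x ^ (e₁ + e₂ + 2)))) / (A + (-(C * x ^ (e₁ + e₂ + 2)))) ^ 2)) by
    field_simp]
  rw [abs_neg, abs_mul, abs_of_nonneg (by positivity : (0 : ℝ) ≤ ((e₁ : ℝ) + e₂ + 2) ^ 2), abs_div, abs_of_pos hsq]
  have := div_le_of_le_mul₀ hsq.le (by
    have : 0 ≤ κ * (A + (-(C * x ^ (e₁ + e₂ + 2)))) ^ 2 := le_trans (abs_nonneg _) hcore
    exact nonneg_of_mul_nonneg_left this hsq) hcore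
  exact mul_le_mul_of_nonneg_left this (by positivity)

/-! ### §3 The zones of the order-6 cells, in window-endpoint form -/

/-- ★ **Middle knee under `L₃`** (E3b's K12 item): letters `b 0 = 0`, `0 < b 1·b 2`, `e₁ < e₂`; if the window `(u,v)` (`0 < u`) lies LEFT of the zone
(`|b 2|·v^s ≤ κ|b 1|`) or RIGHT of it (`|b 1| ≤ κ|b 2|·u^s`), `κ = (s−p)(2s+p)/(40s²)`, then E3b's ring hypothesis holds on `(u,v)`. [this file's theorem] -/
theorem sixthOrder_midKnee_offRing (hlt : e₁ < e₂) (b : Fin 3 → ℝ) (h0 : b 0 = 0) (hsgn : 0 < b 1 * b 2) {u v : ℝ} (hu : 0 < u)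
    (hfar : |b 2| * v ^ (e₂ + 1) ≤ (((e₂ : ℝ) + 1) - ((e₁ : ℝ) + 1)) * (2 * ((e₂ : ℝ) + 1) + ((e₁ : ℝ) + 1)) / (40 * ((e₂ : ℝ) + 1) ^ 2) * |b 1|
      ∨ |b 1| ≤ (((e₂ : ℝ) + 1) - ((e₁ : ℝ) + 1)) * (2 * ((e₂ : ℝ) + 1) + ((e₁ : ℝ) + 1)) / (40 * ((e₂ : ℝ) + 1) ^ 2) * (|b 2| * u ^ (e₂ + 1))) :
    ∀ x ∈ Ioo u v,
      0 < 6 * ((((e₂ : ℝ) + 1) - ((e₁ : ℝ) + 1)) * (2 * ((e₂ : ℝ) + 1) - ((e₁ : ℝ) + 1)) * (2 * ((e₂ : ℝ) + 1) + ((e₁ : ℝ) + 1))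
            * (3 * ((e₂ : ℝ) + 1) + ((e₁ : ℝ) + 1)))
        + 240 * ((3 * ((e₂ : ℝ) + 1) + ((e₁ : ℝ) + 1)) * (2 * ((e₂ : ℝ) + 1) - ((e₁ : ℝ) + 1))) * rowPsi1 e₁ e₂ (b 0) (-(b 1)) (-(b 2)) x
        + 5040 * rowPsi1 e₁ e₂ (b 0) (-(b 1)) (-(b 2)) x ^ 2 := by
  intro x hx
  set p : ℝ := (e₁ : ℝ) + 1 with hp
  set s : ℝ := (e₂ : ℝ) + 1 with hs
  have hp0 : 0 < p := by rw [hp]; positivity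
  have hs0 : 0 < s := by rw [hs]; positivity
  have hps : p < s := by
    rw [hp, hs]; have : (e₁ : ℝ) < e₂ := by exact_mod_cast hlt
    linarith
  have hx0 : 0 < x := hu.trans hx.1
  have hκ : 0 ≤ (s - p) * (2 * s + p) / (40 * s ^ 2) := by
    apply div_nonneg (by nlinarith) (by positivity)
  -- the window is inside the far region
  have hfar' : |-(b 2)| * x ^ (e₂ + 1) ≤ (s - p) * (2 * s + p) / (40 * s ^ 2) * |-(b 1)|
      ∨ |-(b 1)| ≤ (s - p) * (2 * s + p) / (40 * s ^ 2) * (|-(b 2)| * x ^ (e₂ + 1)) := by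
    rw [abs_neg, abs_neg]
    rcases hfar with h | h
    · left
      have hxv : x ^ (e₂ + 1) ≤ v ^ (e₂ + 1) := pow_le_pow_left₀ hx0.le hx.2.le _
      calc |b 2| * x ^ (e₂ + 1) ≤ |b 2| * v ^ (e₂ + 1) := by gcongr
        _ ≤ _ := h
    · right
      have hux : u ^ (e₂ + 1) ≤ x ^ (e₂ + 1) := pow_le_pow_left₀ hu.le hx.1.le _
      calc |b 1| ≤ (s - p) * (2 * s + p) / (40 * s ^ 2) * (|b 2| * u ^ (e₂ + 1)) := h
        _ ≤ (s - p) * (2 * s + p) / (40 * s ^ 2) * (|b 2| * x ^ (e₂ + 1)) := by gcongr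
  have hBC : 0 < (-(b 1)) * (-(b 2)) := by nlinarith
  have hψ := pair12_knee_abs_rowPsi1_le e₁ e₂ (-(b 1)) (-(b 2)) hx0 hBC hfar'
  rw [h0]
  refine quadBracket_pos_of_abs_le (by
    have h1 : 0 < s - p := by linarith
    have h2 : 0 < 2 * s - p := by linarith
    positivity) ?_
  rw [abs_mul, abs_of_pos (by
    have h2 : 0 < 2 * s - p := by linarith
    positivity)]
  rw [← hs] at hψ
  calc 240 * ((3 * s + p) * (2 * s - p)) * |rowPsi1 e₁ e₂ 0 (-(b 1)) (-(b 2)) x|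
      ≤ 240 * ((3 * s + p) * (2 * s - p)) * (s ^ 2 * ((s - p) * (2 * s + p) / (40 * s ^ 2))) := by
        have h2 : 0 < 2 * s - p := by linarith
        gcongr
    _ = 6 * ((s - p) * (2 * s - p) * (2 * s + p) * (3 * s + p)) := by
        field_simp
        ring
    _ ≤ 6 * ((s - p) * (2 * s - p) * (2 * s + p) * (3 * s + p)) := le_rfl

/-- ★ **Fast knee under `L₃`** (E3b's K02 item): letters `b 1 = 0`, `0 < b 0·b 2`; window LEFT (`|b 2|·v^{p+s} ≤ κ|b 0|`) or RIGHT (`|b 0| ≤ κ|b 2|·u^{p+s}`) of the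
zone, `κ = c₀/(c₁(p+s)²)` with `c₀ = 6(12p⁴+56p³s+89p²s²+56ps³+12s⁴)`, `c₁ = 120(12p²+26ps+12s²)`, ⇒ E3b's ring hypothesis on `(u,v)`. [this file's theorem] -/
theorem sixthOrder_fastKnee_offRing (b : Fin 3 → ℝ) (h1 : b 1 = 0) (hsgn : 0 < b 0 * b 2) {u v : ℝ} (hu : 0 < u)
    (hfar : |b 2| * v ^ (e₁ + e₂ + 2)
        ≤ 6 * (12 * ((e₁ : ℝ) + 1) ^ 4 + 56 * ((e₁ : ℝ) + 1) ^ 3 * ((e₂ : ℝ) + 1) + 89 * ((e₁ : ℝ) + 1) ^ 2 * ((e₂ : ℝ) + 1) ^ 2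
              + 56 * ((e₁ : ℝ) + 1) * ((e₂ : ℝ) + 1) ^ 3 + 12 * ((e₂ : ℝ) + 1) ^ 4)
          / (120 * (12 * ((e₁ : ℝ) + 1) ^ 2 + 26 * ((e₁ : ℝ) + 1) * ((e₂ : ℝ) + 1) + 12 * ((e₂ : ℝ) + 1) ^ 2) * ((e₁ : ℝ) + e₂ + 2) ^ 2)
          * |b 0|
      ∨ |b 0| ≤ 6 * (12 * ((e₁ : ℝ) + 1) ^ 4 + 56 * ((e₁ : ℝ) + 1) ^ 3 * ((e₂ : ℝ) + 1) + 89 * ((e₁ : ℝ) + 1) ^ 2 * ((e₂ : ℝ) + 1) ^ 2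
              + 56 * ((e₁ : ℝ) + 1) * ((e₂ : ℝ) + 1) ^ 3 + 12 * ((e₂ : ℝ) + 1) ^ 4)
          / (120 * (12 * ((e₁ : ℝ) + 1) ^ 2 + 26 * ((e₁ : ℝ) + 1) * ((e₂ : ℝ) + 1) + 12 * ((e₂ : ℝ) + 1) ^ 2) * ((e₁ : ℝ) + e₂ + 2) ^ 2)
          * (|b 2| * u ^ (e₁ + e₂ + 2))) :
    ∀ x ∈ Ioo u v,
      0 < 6 * (12 * ((e₁ : ℝ) + 1) ^ 4 + 56 * ((e₁ : ℝ) + 1) ^ 3 * ((e₂ : ℝ) + 1) + 89 * ((e₁ : ℝ) + 1) ^ 2 * ((e₂ : ℝ) + 1) ^ 2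
            + 56 * ((e₁ : ℝ) + 1) * ((e₂ : ℝ) + 1) ^ 3 + 12 * ((e₂ : ℝ) + 1) ^ 4)
        + 120 * (12 * ((e₁ : ℝ) + 1) ^ 2 + 26 * ((e₁ : ℝ) + 1) * ((e₂ : ℝ) + 1) + 12 * ((e₂ : ℝ) + 1) ^ 2)
            * rowPsi1 e₁ e₂ (b 0) (-(b 1)) (-(b 2)) x
        + 5040 * rowPsi1 e₁ e₂ (b 0) (-(b 1)) (-(b 2)) x ^ 2 := by
  intro x hx
  set p : ℝ := (e₁ : ℝ) + 1 with hp
  set s : ℝ := (e₂ : ℝ) + 1 with hs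
  have hp0 : 0 < p := by rw [hp]; positivity
  have hs0 : 0 < s := by rw [hs]; positivity
  have hx0 : 0 < x := hu.trans hx.1
  have hq : ((e₁ : ℝ) + e₂ + 2) = p + s := by rw [hp, hs]; ring
  rw [hq] at hfar
  set κ : ℝ := 6 * (12 * p ^ 4 + 56 * p ^ 3 * s + 89 * p ^ 2 * s ^ 2 + 56 * p * s ^ 3 + 12 * s ^ 4)
      / (120 * (12 * p ^ 2 + 26 * p * s + 12 * s ^ 2) * (p + s) ^ 2) with hκdef
  have hκ : 0 ≤ κ := by rw [hκdef]; positivity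
  have hfar' : |-(b 2)| * x ^ (e₁ + e₂ + 2) ≤ κ * |b 0| ∨ |b 0| ≤ κ * (|-(b 2)| * x ^ (e₁ + e₂ + 2)) := by
    rw [abs_neg]
    rcases hfar with h | h
    · left
      have hxv : x ^ (e₁ + e₂ + 2) ≤ v ^ (e₁ + e₂ + 2) := pow_le_pow_left₀ hx0.le hx.2.le _
      calc |b 2| * x ^ (e₁ + e₂ + 2) ≤ |b 2| * v ^ (e₁ + e₂ + 2) := by gcongr
        _ ≤ _ := h
    · right
      have hux : u ^ (e₁ + e₂ + 2) ≤ x ^ (e₁ + e₂ + 2) := pow_le_pow_left₀ hu.le hx.1.le _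
      calc |b 0| ≤ κ * (|b 2| * u ^ (e₁ + e₂ + 2)) := h
        _ ≤ κ * (|b 2| * x ^ (e₁ + e₂ + 2)) := by gcongr
  have hAC : b 0 * (-(b 2)) < 0 := by nlinarith
  have hψ := knee_abs_rowPsi1_le e₁ e₂ (b 0) (-(b 2)) hx0 hAC hfar'
  rw [hq] at hψ
  rw [h1, neg_zero]
  refine quadBracket_pos_of_abs_le (by positivity) ?_
  rw [abs_mul, abs_of_pos (by positivity)]
  calc 120 * (12 * p ^ 2 + 26 * p * s + 12 * s ^ 2) * |rowPsi1 e₁ e₂ (b 0) 0 (-(b 2)) x|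
      ≤ 120 * (12 * p ^ 2 + 26 * p * s + 12 * s ^ 2) * ((p + s) ^ 2 * κ) := by gcongr
    _ = 6 * (12 * p ^ 4 + 56 * p ^ 3 * s + 89 * p ^ 2 * s ^ 2 + 56 * p * s ^ 3 + 12 * s ^ 4) := by
        rw [hκdef]
        field_simp
    _ ≤ _ := le_rfl

/-- ★ **Fast knee under `L_eq`** (E3c's K02 item, equal gaps `e₁ = e₂ = e`, rate `2a`, `a = e+1`): window LEFT (`32·|b 2|·v^{2a} ≤ |b 0|`) or RIGHT
(`32·|b 0| ≤ |b 2|·u^{2a}`) of the zone (`κ = 1/32`) ⇒ E3c's ring hypothesis on `(u,v)`. [this file's theorem] -/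
theorem equalGap_fastKnee_offRing (e : ℕ) (b : Fin 3 → ℝ) (h1 : b 1 = 0) (hsgn : 0 < b 0 * b 2) {u v : ℝ} (hu : 0 < u)
    (hfar : 32 * (|b 2| * v ^ (e + e + 2)) ≤ |b 0| ∨ 32 * |b 0| ≤ |b 2| * u ^ (e + e + 2)) :
    ∀ x ∈ Ioo u v,
      0 < 630 * ((e : ℝ) + 1) ^ 4 + 5040 * ((e : ℝ) + 1) ^ 2 * rowPsi1 e e (b 0) (-(b 1)) (-(b 2)) x
        + 5040 * rowPsi1 e e (b 0) (-(b 1)) (-(b 2)) x ^ 2 := by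
  intro x hx
  set a : ℝ := (e : ℝ) + 1 with ha
  have ha0 : 0 < a := by rw [ha]; positivity
  have hx0 : 0 < x := hu.trans hx.1
  have hq : ((e : ℝ) + e + 2) = 2 * a := by rw [ha]; ring
  have hfar' : |-(b 2)| * x ^ (e + e + 2) ≤ (1 / 32) * |b 0| ∨ |b 0| ≤ (1 / 32) * (|-(b 2)| * x ^ (e + e + 2)) := by
    rw [abs_neg]
    rcases hfar with h | h
    · left
      have hxv : x ^ (e + e + 2) ≤ v ^ (e + e + 2) := pow_le_pow_left₀ hx0.le hx.2.le _
      calc |b 2| * x ^ (e + e + 2) ≤ |b 2| * v ^ (e + e + 2) := by gcongr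
        _ ≤ (1 / 32) * |b 0| := by linarith
    · right
      have hux : u ^ (e + e + 2) ≤ x ^ (e + e + 2) := pow_le_pow_left₀ hu.le hx.1.le _
      calc |b 0| ≤ (1 / 32) * (|b 2| * u ^ (e + e + 2)) := by linarith
        _ ≤ (1 / 32) * (|b 2| * x ^ (e + e + 2)) := by gcongr
  have hAC : b 0 * (-(b 2)) < 0 := by nlinarith
  have hψ := knee_abs_rowPsi1_le e e (b 0) (-(b 2)) hx0 hAC hfar'
  rw [hq] at hψ
  rw [h1, neg_zero]
  have hψ' : |5040 * a ^ 2 * rowPsi1 e e (b 0) 0 (-(b 2)) x| ≤ 630 * a ^ 4 := by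
    rw [abs_mul, abs_of_pos (by positivity)]
    calc 5040 * a ^ 2 * |rowPsi1 e e (b 0) 0 (-(b 2)) x| ≤ 5040 * a ^ 2 * ((2 * a) ^ 2 * (1 / 32)) := by gcongr
      _ = 630 * a ^ 4 := by ring
      _ ≤ 630 * a ^ 4 := le_rfl
  exact quadBracket_pos_of_abs_le (by positivity) hψ'

end ProductPlusOne

end Summit.ValiantsHypothesis.ValiantsHypothesis.Theorems.LacunarySymmetroidMatrixDescartes
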